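import Literature.NumberTheory.Automorphic.UnitarySimilitudeNormTorus
import Literature.NumberTheory.Automorphic.UnitaryGroupAutomorphicRep
import HarnessLib

/-!
# Rapoport–Smithling–Zhang's group `G̃ = Z^ℚ ×_{𝔾_m} G^ℚ` on points: the scalars `Z^ℚ` form a central subgroup of the
# unitary similitude group `G^ℚ`, and `G̃ ≅ Z^ℚ × U(W)`, `(z, g) ↦ (z, z⁻¹ g)`

Topic `NumberTheory/Automorphic`, namespace `Literature.NumberTheory.Automorphic.UnitarySimilitude` (lane
`lit-hodgefound`, Track 2 foundations; seat `lit-hodgefound-p11`, generation 30, row g30-#5).  THEOREMS ONLY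
(D-0026): no definition, no named fact, no instance, no notation.  Sequel of ✔ `UnitarySimilitudeNormTorus` (g30-#4:
the similitude group `GU(J)(A) = {(g, t) ∈ GL_n(R) × Aˣ : ᵗσ(g) J g = ι(t) J}` on points, Kottwitz's torus
`D_m = {(x, t) : σ(x) x = ι(t)^m}`, `(det, c) : GU(J)(A) → D_n(A)`, and `D_1(A) ≅ {y : σ(y) y ∈ ι(Aˣ)} = Z^ℚ(A)`) and of
the tree's unitary group `unitaryGroupOfForm σ J ≤ GL_n(R)` (`Automorphic/UnitaryGroupAutomorphicRep`).

## The print, verbatim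

M. Rapoport, B. Smithling, W. Zhang, *Arithmetic diagonal cycles on unitary Shimura varieties*, Compos. Math. **156**
(2020) [RapoportSmithlingZhang2017] (arXiv:1710.06962, held text `paper:arxiv-1710.06962` p0008 L27–L57), §3.1:
«We systematically use the symbol `c` to denote the similitude factor of a point on a unitary similitude group.
`Z^ℚ := {z ∈ Res_{F/ℚ} 𝔾_m | Nm_{F/F₀}(z) ∈ 𝔾_m}`, `G^ℚ := {g ∈ Res_{F₀/ℚ} GU(W) | c(g) ∈ 𝔾_m}`,
`G̃ := Z^ℚ ×_{𝔾_m} G^ℚ = {(z, g) ∈ Z^ℚ × G^ℚ | Nm_{F/F₀}(z) = c(g)}` […]. Note that `Z^ℚ` is naturally a central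
subgroup of `H^ℚ` and `G^ℚ`, and these inclusions give rise to product decompositions
`G̃ ⥲ Z^ℚ × Res_{F₀/ℚ} G`, `(z, g) ↦ (z, z⁻¹ g)`» (here `G = U(W)` is the unitary group of `W` over `F₀`).

## What is formalised (points in a tower `A →ι R ⟲ σ`, as in g30-#4)

`R`, `A` commutative rings, `σ : R →+* R`, `ι : A →+* R`; `J ∈ M_n(R)` the Gram matrix of `W`; the similitude group
`G ≤ GL_n(R) × Aˣ` and Kottwitz's family `D_m ≤ Rˣ × Aˣ` enter through their membership conditions (`hG`, `hD`, both
shown to exist and to be unique in g30-#4); RSZ's `G̃(A)` is the subgroup `G̃ ≤ Rˣ × (GL_n(R) × Aˣ)` with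
`(z, (g, t)) ∈ G̃ ⟺ σ(z) z = ι(t) ∧ (g, t) ∈ G` (hypothesis `hGt`; `exists_subgroup_tilde_forall_mem_iff`,
`subgroup_tilde_eq_of_forall_mem_iff`) — i.e. `Nm(z) = c(g)`, the common value `t ∈ 𝔾_m(A)` being recorded.

* §1 **`scalar_similitude`** (`ᵗσ(z·1) J (z·1) = (σ(z) z) J`: scalars are similitudes with multiplier `Nm(z)`),
  **`scalar_mk_mem`** (`Z^ℚ ⊂ G^ℚ`: `(z·1, t) ∈ G` when `σ(z) z = ι(t)`), `scalar_mk_mul_comm` (it is central).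
* §2 `exists_subgroup_tilde_forall_mem_iff`, `subgroup_tilde_eq_of_forall_mem_iff`,
  `scalar_inv_mul_mem_unitaryGroupOfForm` (`(z, (g, t)) ∈ G̃ ⟹ z⁻¹ g ∈ U(J)`), `scalar_mul_mem`
  (`(z, t) ∈ D_1`, `u ∈ U(J) ⟹ (z, (z u, t)) ∈ G̃`), **`exists_mulEquiv_tilde_prod`** (RSZ's product decomposition
  `G̃(A) ≅ D_1(A) × U(J)(A)`, `(z, (g, t)) ↦ ((z, t), z⁻¹ g)`), and **`exists_mulEquiv_tilde_prod'`** (`ι` injective,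
  `σ ∘ ι = ι`: `G̃(A) ≅ Z^ℚ(A) × U(J)(A)` with `Z^ℚ(A) = {y ∈ Rˣ : σ(y) y ∈ ι(Aˣ)}`, first coordinate `z`, second
  `z⁻¹ g` — the printed `(z, g) ↦ (z, z⁻¹ g)`).

For `R = F ⊗_ℚ A'`, `σ = c ⊗ 1`, `ι` the structure map these are the `A'`-points of RSZ's isomorphism of `ℚ`-groups,
natural in `A'`.  Nothing about Shimura data (`h_{Z^ℚ}`, `h_{G̃}`) or moduli problems is formalised here; the file
serves DAG-C rows C3-06/C3-07 (passing between `U(V)`-data and PEL-type `G̃`-data).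

## References

* [RapoportSmithlingZhang2017] M. Rapoport, B. Smithling, W. Zhang, *Arithmetic diagonal cycles on unitary Shimura
  varieties*, Compos. Math. 156 (2020) 1745–1824, §3.1.
* [Kottwitz1992] R. E. Kottwitz, *Points on some Shimura varieties over finite fields*, J. Amer. Math. Soc. 5 (1992),
  §5 p. 389, §7 pp. 393–394.
-/

open scoped Matrix

namespace Literature.NumberTheory.Automorphic.UnitarySimilitude

variable {R A : Type*} [CommRing R] [CommRing A] (σ : R →+* R) (ι : A →+* R) {n : Type*} [Fintype n]
  [DecidableEq n]

/-! ## §1 Scalars are central similitudes: `Z^ℚ ⊂ G^ℚ` -/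

omit [Fintype n] in
/-- **Scalars are similitudes with multiplier `Nm(z) = σ(z) z`**: `ᵗσ(z·1) J (z·1) = (σ(z) z) • J`.
[cite: RapoportSmithlingZhang2017, §3.1] -/
theorem scalar_similitude [Fintype n] (J : Matrix n n R) (z : Rˣ) :
    (((Matrix.GeneralLinearGroup.scalar n z : GL n R) : Matrix n n R).map σ)ᵀ * J *
        ((Matrix.GeneralLinearGroup.scalar n z : GL n R) : Matrix n n R) = (σ z * z : R) • J := by
  rw [Matrix.GeneralLinearGroup.coe_scalar, Matrix.scalar_apply, Matrix.diagonal_map (map_zero σ),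
    Matrix.diagonal_transpose, ← Matrix.smul_one_eq_diagonal, ← Matrix.smul_one_eq_diagonal, Matrix.smul_mul,
    Matrix.one_mul, Matrix.mul_smul, Matrix.mul_one, smul_smul, mul_comm]

/-- **`Z^ℚ ⊂ G^ℚ`**: if `σ(z) z = ι(t)` then `(z·1, t)` lies in the similitude group `G = GU(J)(A)`
(«`Z^ℚ` is naturally a central subgroup of `G^ℚ`»). [cite: RapoportSmithlingZhang2017, §3.1] -/
theorem scalar_mk_mem {J : Matrix n n R} {G : Subgroup (GL n R × Aˣ)}
    (hG : ∀ p, p ∈ G ↔ ((p.1 : Matrix n n R).map σ)ᵀ * J * (p.1 : Matrix n n R) = ι (p.2 : A) • J)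
    {z : Rˣ} {t : Aˣ} (hz : Units.map (σ : R →* R) z * z = Units.map (ι : A →* R) t) :
    (Matrix.GeneralLinearGroup.scalar n z, t) ∈ G := by
  rw [hG, scalar_similitude σ J z]
  have h := congrArg Units.val hz
  rw [Units.val_mul, Units.coe_map, MonoidHom.coe_coe, Units.coe_map, MonoidHom.coe_coe] at h
  rw [h]

omit [Fintype n] in
/-- … and `(z·1, t)` is central in `GL_n(R) × Aˣ`. [cite: RapoportSmithlingZhang2017, §3.1] -/
theorem scalar_mk_mul_comm [Fintype n] (z : Rˣ) (t : Aˣ) (p : GL n R × Aˣ) :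
    (Matrix.GeneralLinearGroup.scalar n z, t) * p = p * (Matrix.GeneralLinearGroup.scalar n z, t) := by
  ext : 1
  · exact Matrix.GeneralLinearGroup.scalar_commute z p.1
  · exact mul_comm t p.2

/-! ## §2 `G̃ = Z^ℚ ×_{𝔾_m} G^ℚ ≅ Z^ℚ × U(W)`, `(z, g) ↦ (z, z⁻¹ g)` -/

/-- RSZ's `G̃(A) = {(z, (g, t)) : σ(z) z = ι(t), (g, t) ∈ GU(J)(A)}` («`Nm_{F/F₀}(z) = c(g)`») is a subgroup of
`Rˣ × (GL_n(R) × Aˣ)` (non-vacuity of `hGt`). [cite: RapoportSmithlingZhang2017, §3.1] -/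
theorem exists_subgroup_tilde_forall_mem_iff (G : Subgroup (GL n R × Aˣ)) :
    ∃ Gt : Subgroup (Rˣ × (GL n R × Aˣ)), ∀ q, q ∈ Gt ↔
      Units.map (σ : R →* R) q.1 * q.1 = Units.map (ι : A →* R) q.2.2 ∧ q.2 ∈ G := by
  obtain ⟨D, hD⟩ := exists_forall_mem_iff (A := A) σ ι
  refine ⟨(D 1).comap ((MonoidHom.fst Rˣ (GL n R × Aˣ)).prod
      ((MonoidHom.snd (GL n R) Aˣ).comp (MonoidHom.snd Rˣ (GL n R × Aˣ)))) ⊓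
    G.comap (MonoidHom.snd Rˣ (GL n R × Aˣ)), fun q => ?_⟩
  rw [Subgroup.mem_inf, Subgroup.mem_comap, Subgroup.mem_comap, hD, pow_one]
  exact Iff.rfl

/-- The membership condition determines `G̃(A)`. [cite: RapoportSmithlingZhang2017, §3.1] -/
theorem subgroup_tilde_eq_of_forall_mem_iff {G : Subgroup (GL n R × Aˣ)} {Gt Gt' : Subgroup (Rˣ × (GL n R × Aˣ))}
    (hGt : ∀ q, q ∈ Gt ↔ Units.map (σ : R →* R) q.1 * q.1 = Units.map (ι : A →* R) q.2.2 ∧ q.2 ∈ G)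
    (hGt' : ∀ q, q ∈ Gt' ↔ Units.map (σ : R →* R) q.1 * q.1 = Units.map (ι : A →* R) q.2.2 ∧ q.2 ∈ G) :
    Gt = Gt' :=
  Subgroup.ext fun q => (hGt q).trans (hGt' q).symm

/-- **`z⁻¹ g ∈ U(W)`**: for `(z, (g, t)) ∈ G̃(A)` the element `z⁻¹ g` has multiplier `Nm(z)⁻¹ c(g) = 1`, i.e. lies in
`unitaryGroupOfForm σ J`. [cite: RapoportSmithlingZhang2017, §3.1] -/
theorem scalar_inv_mul_mem_unitaryGroupOfForm {J : Matrix n n R} {g : GL n R} {z : Rˣ} {t : Aˣ}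
    (hz : Units.map (σ : R →* R) z * z = Units.map (ι : A →* R) t)
    (hg : ((g : Matrix n n R).map σ)ᵀ * J * (g : Matrix n n R) = ι (t : A) • J) :
    Matrix.GeneralLinearGroup.scalar n z⁻¹ * g ∈ unitaryGroupOfForm σ J := by
  rw [mem_unitaryGroupOfForm_iff]
  have hs : (((Matrix.GeneralLinearGroup.scalar n z⁻¹ : GL n R) : Matrix n n R).map σ)ᵀ * J *
      ((Matrix.GeneralLinearGroup.scalar n z⁻¹ : GL n R) : Matrix n n R) =
        (((Units.map (σ : R →* R) z * z)⁻¹ : Rˣ) : R) • J := by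
    rw [scalar_similitude σ J z⁻¹, mul_inv, ← map_inv, Units.val_mul, Units.coe_map, MonoidHom.coe_coe]
  rw [hz] at hs
  have h := mul_similitude σ hs hg
  rw [← MonoidHom.coe_coe ι, ← Units.coe_map, ← Units.val_mul, ← Units.val_mul, inv_mul_cancel,
    Units.val_one, one_smul] at h
  exact h

/-- Conversely `(z, t) ∈ D_1(A)` and `u ∈ U(J)(A)` give `(z, (z u, t)) ∈ G̃(A)`: `z u` is a similitude with multiplier
`Nm(z) = ι(t)`. [cite: RapoportSmithlingZhang2017, §3.1] -/
theorem scalar_mul_similitude {J : Matrix n n R} {u : GL n R} {z : Rˣ} {t : Aˣ}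
    (hz : Units.map (σ : R →* R) z * z = Units.map (ι : A →* R) t) (hu : u ∈ unitaryGroupOfForm σ J) :
    (((Matrix.GeneralLinearGroup.scalar n z * u : GL n R) : Matrix n n R).map σ)ᵀ * J *
        ((Matrix.GeneralLinearGroup.scalar n z * u : GL n R) : Matrix n n R) = ι (t : A) • J := by
  rw [mem_unitaryGroupOfForm_iff] at hu
  have hu' : ((u : Matrix n n R).map σ)ᵀ * J * (u : Matrix n n R) = (1 : R) • J := by rw [hu, one_smul]
  have h := mul_similitude σ (scalar_similitude σ J z) hu'
  have hzv := congrArg Units.val hz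
  rw [Units.val_mul, Units.coe_map, MonoidHom.coe_coe, Units.coe_map, MonoidHom.coe_coe] at hzv
  rw [mul_one, hzv] at h
  rw [Units.val_mul]
  exact h

/-- **RSZ's product decomposition `G̃ ≅ Z^ℚ × U(W)`, `(z, g) ↦ (z, z⁻¹ g)`, on points** — with `Z^ℚ(A)` written as
Kottwitz's `D_1(A) = {(z, t) : σ(z) z = ι(t)}` (the norm being recorded): `G̃(A) ≅ D_1(A) × U(J)(A)`,
`(z, (g, t)) ↦ ((z, t), z⁻¹ g)`, inverse `((z, t), u) ↦ (z, (z u, t))`. [cite: RapoportSmithlingZhang2017, §3.1] -/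
theorem exists_mulEquiv_tilde_prod {J : Matrix n n R} {G : Subgroup (GL n R × Aˣ)}
    (hG : ∀ p, p ∈ G ↔ ((p.1 : Matrix n n R).map σ)ᵀ * J * (p.1 : Matrix n n R) = ι (p.2 : A) • J)
    {D : ℕ → Subgroup (Rˣ × Aˣ)}
    (hD : ∀ m p, p ∈ D m ↔ Units.map (σ : R →* R) p.1 * p.1 = Units.map (ι : A →* R) p.2 ^ m)
    {Gt : Subgroup (Rˣ × (GL n R × Aˣ))}
    (hGt : ∀ q, q ∈ Gt ↔ Units.map (σ : R →* R) q.1 * q.1 = Units.map (ι : A →* R) q.2.2 ∧ q.2 ∈ G) :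
    ∃ e : Gt ≃* D 1 × unitaryGroupOfForm σ J, ∀ q : Gt,
      (((e q).1 : D 1) : Rˣ × Aˣ) = ((q : Rˣ × (GL n R × Aˣ)).1, (q : Rˣ × (GL n R × Aˣ)).2.2) ∧
        (((e q).2 : unitaryGroupOfForm σ J) : GL n R) =
          Matrix.GeneralLinearGroup.scalar n ((q : Rˣ × (GL n R × Aˣ)).1)⁻¹ * (q : Rˣ × (GL n R × Aˣ)).2.1 := by
  -- membership bookkeeping
  have hD1 : ∀ q : Gt, ((q : Rˣ × (GL n R × Aˣ)).1, (q : Rˣ × (GL n R × Aˣ)).2.2) ∈ D 1 := fun q => by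
    rw [hD, pow_one]; exact ((hGt _).1 q.2).1
  have hU : ∀ q : Gt, Matrix.GeneralLinearGroup.scalar n ((q : Rˣ × (GL n R × Aˣ)).1)⁻¹ *
      (q : Rˣ × (GL n R × Aˣ)).2.1 ∈ unitaryGroupOfForm σ J := fun q =>
    scalar_inv_mul_mem_unitaryGroupOfForm σ ι ((hGt _).1 q.2).1 ((hG _).1 ((hGt _).1 q.2).2)
  have hback : ∀ p : D 1 × unitaryGroupOfForm σ J,
      (((p.1 : D 1) : Rˣ × Aˣ).1, (Matrix.GeneralLinearGroup.scalar n ((p.1 : D 1) : Rˣ × Aˣ).1 *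
        ((p.2 : unitaryGroupOfForm σ J) : GL n R), ((p.1 : D 1) : Rˣ × Aˣ).2)) ∈ Gt := fun p => by
    have hz : Units.map (σ : R →* R) ((p.1 : D 1) : Rˣ × Aˣ).1 * ((p.1 : D 1) : Rˣ × Aˣ).1 =
        Units.map (ι : A →* R) ((p.1 : D 1) : Rˣ × Aˣ).2 := by
      have h := (hD 1 _).1 p.1.2
      rwa [pow_one] at h
    rw [hGt]
    exact ⟨hz, (hG _).2 (scalar_mul_similitude σ ι hz p.2.2)⟩
  refine ⟨{ toFun := fun q => (⟨_, hD1 q⟩, ⟨_, hU q⟩)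
            invFun := fun p => ⟨_, hback p⟩
            left_inv := fun q => ?_
            right_inv := fun p => ?_
            map_mul' := fun q q' => ?_ }, fun q => ⟨rfl, rfl⟩⟩
  · apply Subtype.ext
    ext : 1
    · rfl
    · ext : 1
      · show Matrix.GeneralLinearGroup.scalar n (q : Rˣ × (GL n R × Aˣ)).1 *
            (Matrix.GeneralLinearGroup.scalar n ((q : Rˣ × (GL n R × Aˣ)).1)⁻¹ * (q : Rˣ × (GL n R × Aˣ)).2.1) =
            (q : Rˣ × (GL n R × Aˣ)).2.1
        rw [map_inv, mul_inv_cancel_left]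
      · rfl
  · apply Prod.ext
    · rfl
    · apply Subtype.ext
      show Matrix.GeneralLinearGroup.scalar n (((p.1 : D 1) : Rˣ × Aˣ).1)⁻¹ *
          (Matrix.GeneralLinearGroup.scalar n ((p.1 : D 1) : Rˣ × Aˣ).1 * ((p.2 : unitaryGroupOfForm σ J) : GL n R)) =
          ((p.2 : unitaryGroupOfForm σ J) : GL n R)
      rw [map_inv, inv_mul_cancel_left]
  · apply Prod.ext
    · rfl
    · apply Subtype.ext
      show Matrix.GeneralLinearGroup.scalar n ((q : Rˣ × (GL n R × Aˣ)).1 * (q' : Rˣ × (GL n R × Aˣ)).1)⁻¹ *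
          ((q : Rˣ × (GL n R × Aˣ)).2.1 * (q' : Rˣ × (GL n R × Aˣ)).2.1) =
          Matrix.GeneralLinearGroup.scalar n ((q : Rˣ × (GL n R × Aˣ)).1)⁻¹ * (q : Rˣ × (GL n R × Aˣ)).2.1 *
            (Matrix.GeneralLinearGroup.scalar n ((q' : Rˣ × (GL n R × Aˣ)).1)⁻¹ * (q' : Rˣ × (GL n R × Aˣ)).2.1)
      rw [mul_inv, map_mul, mul_assoc, mul_assoc,
        ← mul_assoc (Matrix.GeneralLinearGroup.scalar n ((q' : Rˣ × (GL n R × Aˣ)).1)⁻¹)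
          ((q : Rˣ × (GL n R × Aˣ)).2.1) ((q' : Rˣ × (GL n R × Aˣ)).2.1),
        Matrix.GeneralLinearGroup.scalar_commute ((q' : Rˣ × (GL n R × Aˣ)).1)⁻¹ ((q : Rˣ × (GL n R × Aˣ)).2.1),
        mul_assoc]

/-- **RSZ's `G̃ ≅ Z^ℚ × U(W)` with `Z^ℚ(A) = {y ∈ Rˣ : σ(y) y ∈ ι(Aˣ)}`** (`ι` injective, `σ ∘ ι = ι`): first coordinate
`z`, second `z⁻¹ g` — the printed `(z, g) ↦ (z, z⁻¹ g)`. [cite: RapoportSmithlingZhang2017, §3.1]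
[cite: Kottwitz1992, §7 p. 394] -/
theorem exists_mulEquiv_tilde_prod' (hσι : ∀ a, σ (ι a) = ι a) (hι : Function.Injective ι) {J : Matrix n n R}
    {G : Subgroup (GL n R × Aˣ)}
    (hG : ∀ p, p ∈ G ↔ ((p.1 : Matrix n n R).map σ)ᵀ * J * (p.1 : Matrix n n R) = ι (p.2 : A) • J)
    {Z : Subgroup Rˣ} (hZ : ∀ y, y ∈ Z ↔ ∃ s : Aˣ, Units.map (σ : R →* R) y * y = Units.map (ι : A →* R) s)
    {Gt : Subgroup (Rˣ × (GL n R × Aˣ))}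
    (hGt : ∀ q, q ∈ Gt ↔ Units.map (σ : R →* R) q.1 * q.1 = Units.map (ι : A →* R) q.2.2 ∧ q.2 ∈ G) :
    ∃ e : Gt ≃* Z × unitaryGroupOfForm σ J, ∀ q : Gt,
      (((e q).1 : Z) : Rˣ) = (q : Rˣ × (GL n R × Aˣ)).1 ∧
        (((e q).2 : unitaryGroupOfForm σ J) : GL n R) =
          Matrix.GeneralLinearGroup.scalar n ((q : Rˣ × (GL n R × Aˣ)).1)⁻¹ * (q : Rˣ × (GL n R × Aˣ)).2.1 := by
  obtain ⟨D, hD⟩ := exists_forall_mem_iff (A := A) σ ι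
  obtain ⟨e₁, he₁⟩ := exists_mulEquiv_tilde_prod σ ι hG hD hGt
  obtain ⟨e₂, he₂⟩ := exists_mulEquiv_one σ ι hσι hι hD hZ
  refine ⟨e₁.trans (MulEquiv.prodCongr e₂ (MulEquiv.refl _)), fun q => ⟨?_, (he₁ q).2⟩⟩
  show ((e₂ (e₁ q).1 : Z) : Rˣ) = _
  rw [he₂, (he₁ q).1]

end Literature.NumberTheory.Automorphic.UnitarySimilitude
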